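import Summits.Ventures.YMGap.Census.CubeFactorization
import Literature.MathematicalPhysics.QuantumFieldTheory.TomboulisHypercubeExponent
import HarnessLib

/-!
# Venture YMGap, track (b) — Tomboulis's Prop. II.1 (ii), eq. (2.13), with the exponent of its proof, on EVERY even
# torus: `Z_Λ({c_j}) ≥ (1 + Σ_{j≠0} d_j² c_j⁶)^{L^d/4}` (`Λ = (ℤ/Lℤ)^d`, `L` even, `d ≥ 3`, every spin cut-off)

HONEST FRAMING: venture file of the cell `pub-ymgap` (QuantumFields programme), track (b); a finite-torus inequality for
the character-truncated `SU(2)` Wilson partition function `torusZ`; nothing about (5.15), limits, confinement or a mass gap.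

E. T. Tomboulis, arXiv:0707.2179, Prop. II.1 (ii) eq. (2.13) prints `Z_Λ({c_j}) ≥ [1 + Σ_{j≠0} d_j² c_j⁶]^{|Λ|}`; its
proof (App. A (A.1)–(A.5)) drops, by reflection positivity (in lattice planes without sites, iterated halvings of a torus of
sides `2^{m_μ}`), all plaquettes outside a family of link-disjoint unit cubes and evaluates each cube, so the exponent the
argument delivers is the number of those cubes.  The tree records the inequality with the exponent as a parameter,
`Tomboulis2007.HypercubeLowerBoundExp d L J m` (`TomboulisVortexDecimation`); with the printed exponent it is false already
on `3³` (`Census.not_hypercubeLowerBoundExp_333`, K-conditional).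

**`hypercubeLowerBoundExp_quarter`**: for every EVEN `L`, every `d ≥ 3` and every spin cut-off `J`,
`HypercubeLowerBoundExp d L J (L^d / 4)`.  Proof (the cell's kernel version of App. A, with chessboard/translation RP on
the whole torus instead of iterated halvings, so that every even `L` is covered, not only `L = 2^m`):
`Z_Λ(c) ≥ ∫ ∏_{p ∈ S₀} f_c(U_p)` for the reflection-transportable pattern `S₀` of the faces of the unit 3-cubes in the
directions `0 < 1 < 2` with equal-parity base points (`PatternMonotone.coefFieldZ_pattern_le_torusZ`,
`CubePattern.cubePattern_transport`) `= (1 + Σ_{n=1}^{J} (n+1)² c_n⁶)^{#cubes}` (`CubeFactorization`) and `#cubes = L^d/4`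
(`card_cubeBases`).  Corollaries: every exponent `m ≤ L^d/4`, and the weak form (2.14) `Z_Λ ≥ 1`.

References: E. T. Tomboulis, arXiv:0707.2179, Prop. II.1 (ii), App. A §1 [cite: Tomboulis2007Confinement, Prop. II.1 (ii)
eq. (2.13); App. A (A.1)–(A.5)].
-/

noncomputable section

open MeasureTheory Finset
open scoped BigOperators
open Literature.MathematicalPhysics.QuantumLattice
open Literature.MathematicalPhysics.QuantumFieldTheory
open Literature.MathematicalPhysics.QuantumFieldTheory.Tomboulis2007
open Literature.MathematicalPhysics.QuantumFieldTheory.WilsonRP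

namespace Summit.Ventures.YMGap.Census

variable {d L : ℕ}

/-! ### Counting the pattern cubes -/

/-- **The equal-parity cubes are a quarter of the sites**: `#cubeBases i j k = L^d / 4` (`L` even; `i, j, k` distinct).
The four classes of `(par_i - par_k, par_j - par_k) ∈ (ℤ/2)²` are permuted transitively by the unit translations in the
directions `i` and `j`. -/
theorem card_cubeBases [NeZero L] (hL : Even L) {i j k : Fin d} (hij : i ≠ j) (hik : i ≠ k) (hjk : j ≠ k) :
    (cubeBases (L := L) i j k).card = L ^ d / 4 := by
  classical
  obtain ⟨φ, hφ⟩ : ∃ φ : Site d L → ZMod 2 × ZMod 2,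
      ∀ β, φ β = (sitePar β i - sitePar β k, sitePar β j - sitePar β k) := ⟨_, fun _ => rfl⟩
  obtain ⟨fib, hfib⟩ : ∃ fib : ZMod 2 × ZMod 2 → Finset (Site d L),
      ∀ b, fib b = univ.filter fun β => φ β = b := ⟨_, fun _ => rfl⟩
  -- the unit translations shift the class
  have hpar : ∀ (a m : Fin d) (β : Site d L),
      sitePar (β + Pi.single a 1) m = sitePar β m + (Pi.single a (1 : ZMod 2) : Fin d → ZMod 2) m :=
    fun a m β => by rw [show β + Pi.single a 1 = β.shift a from rfl, sitePar_shift hL, Pi.add_apply]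
  have hti : ∀ β : Site d L, φ (β + Pi.single i 1) = φ β + (1, 0) := fun β => by
    rw [hφ, hφ, hpar, hpar, hpar, Pi.single_eq_same, Pi.single_eq_of_ne (Ne.symm hij),
      Pi.single_eq_of_ne (Ne.symm hik), Prod.mk_add_mk]
    refine Prod.ext ?_ ?_ <;> dsimp only <;> ring
  have htj : ∀ β : Site d L, φ (β + Pi.single j 1) = φ β + (0, 1) := fun β => by
    rw [hφ, hφ, hpar, hpar, hpar, Pi.single_eq_same, Pi.single_eq_of_ne hij, Pi.single_eq_of_ne (Ne.symm hjk),
      Prod.mk_add_mk]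
    refine Prod.ext ?_ ?_ <;> dsimp only <;> ring
  have hcard : ∀ (a : Fin d) (δ : ZMod 2 × ZMod 2), (∀ β : Site d L, φ (β + Pi.single a 1) = φ β + δ) →
      ∀ b, (fib b).card = (fib (b + δ)).card := by
    intro a δ ha b
    rw [hfib, hfib]
    refine card_equiv (Equiv.addRight (Pi.single a (1 : ZMod L))) fun β => ?_
    simp only [mem_filter, mem_univ, true_and, Equiv.coe_addRight, ha, add_left_inj]
  have h10 := hcard i (1, 0) hti
  have h01 := hcard j (0, 1) htj
  -- all four classes have the cardinality of the class `0`
  have hall : ∀ b, (fib b).card = (fib 0).card := by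
    have e1 : ((0 : ZMod 2 × ZMod 2) + (1, 0)) = (1, 0) := by decide
    have e2 : ((0 : ZMod 2 × ZMod 2) + (0, 1)) = (0, 1) := by decide
    have e3 : (((1, 0) : ZMod 2 × ZMod 2) + (0, 1)) = (1, 1) := by decide
    have c10 : (fib (1, 0)).card = (fib 0).card := by rw [← e1, ← h10]
    have c01 : (fib (0, 1)).card = (fib 0).card := by rw [← e2, ← h01]
    have c11 : (fib (1, 1)).card = (fib 0).card := by rw [← e3, ← h01, c10]
    have two : ∀ u : ZMod 2, u = 0 ∨ u = 1 := by decide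
    rintro ⟨u, v⟩
    rcases two u with rfl | rfl <;> rcases two v with rfl | rfl
    · rfl
    · exact c01
    · exact c10
    · exact c11
  -- count
  have hsum : (univ : Finset (Site d L)).card = ∑ b : ZMod 2 × ZMod 2, (fib b).card := by
    rw [card_eq_sum_card_fiberwise (f := φ) (t := univ) fun β _ => mem_coe.2 (mem_univ _)]
    simp only [← hfib]
  rw [sum_congr rfl fun b _ => hall b, sum_const, card_univ (α := ZMod 2 × ZMod 2), smul_eq_mul, Fintype.card_prod,
    ZMod.card] at hsum
  have hsite : (univ : Finset (Site d L)).card = L ^ d := by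
    rw [card_univ]
    simp [Fintype.card_pi, ZMod.card]
  have h0 : fib 0 = cubeBases i j k := by
    ext β
    rw [hfib, mem_filter, mem_cubeBases, mem_parClass, hφ, Prod.mk_eq_zero, sub_eq_zero, sub_eq_zero]
    simp only [mem_univ, true_and]
    exact ⟨fun h => ⟨h.1.trans h.2.symm, h.2⟩, fun h => ⟨h.1.trans h.2, h.2⟩⟩
  rw [hsite, h0] at hsum
  generalize L ^ d = N at hsum ⊢
  omega

/-! ### Prop. II.1 (ii) eq. (2.13) with exponent `L^d / 4` -/

/-- The equal-parity cube pattern is reflection-transportable. -/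
theorem isReflTransportable_cubePattern [NeZero d] [NeZero L] [Fact (1 < L)] (hL : Even L) {i j k : Fin d}
    (hij : i < j) (hjk : j < k) : IsReflTransportable (cubePattern (L := L) (dirs3 i j k) (parClass i j k)) :=
  fun p₀ => cubePattern_transport hL (card_dirs3 hij hjk) (isOutsideClosed_parClass i j k) p₀

/-- **(2.13) for three chosen directions**: `(1 + Σ (n+1)² c_n⁶)^{#cubeBases i j k} ≤ Z_Λ({c_j})` for `c_j ≥ 0`. -/
theorem pow_card_cubeBases_le_torusZ [NeZero d] [NeZero L] [Fact (1 < L)] (hL : Even L) (J : ℕ) {c : ℕ → ℝ}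
    (hc : ∀ n, 1 ≤ n → 0 ≤ c n) {i j k : Fin d} (hij : i < j) (hjk : j < k) :
    (1 + ∑ n ∈ Icc 1 J, ((n : ℝ) + 1) ^ 2 * c n ^ 6) ^ (cubeBases (L := L) i j k).card ≤ torusZ d L J c := by
  rw [← coefFieldZ_basePatternField_cubePattern hL J c hij hjk]
  exact coefFieldZ_pattern_le_torusZ hL J hc (isReflTransportable_cubePattern hL hij hjk)

/-- **Tomboulis's Prop. II.1 (ii), eq. (2.13), with the exponent its App. A proof delivers, on every even torus**:
`HypercubeLowerBoundExp d L J (L^d / 4)` — `Z_Λ({c_j}) ≥ (1 + Σ_{j≠0} d_j² c_j⁶)^{L^d/4}` for `Λ = (ℤ/Lℤ)^d` with `L`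
even, `d ≥ 3`, every spin cut-off `J` and all admissible coefficients `0 ≤ c_j ≤ 1` (only `0 ≤ c_j` is used). -/
theorem hypercubeLowerBoundExp_quarter (hd : 3 ≤ d) [NeZero L] (hL : Even L) (J : ℕ) :
    HypercubeLowerBoundExp d L J (L ^ d / 4) := by
  intro c hc
  haveI : NeZero d := ⟨by omega⟩
  have hL1 : 1 < L := by
    have h0 : L ≠ 0 := NeZero.ne L
    obtain ⟨m, hm⟩ := hL
    omega
  haveI : Fact (1 < L) := ⟨hL1⟩
  have hij : (⟨0, by omega⟩ : Fin d) < ⟨1, by omega⟩ := Fin.mk_lt_mk.2 (by norm_num)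
  have hjk : (⟨1, by omega⟩ : Fin d) < ⟨2, by omega⟩ := Fin.mk_lt_mk.2 (by norm_num)
  rw [← card_cubeBases hL hij.ne (hij.trans hjk).ne hjk.ne]
  exact pow_card_cubeBases_le_torusZ hL J (fun n hn => (hc n hn).1) hij hjk

/-- Hence (2.13) with every exponent `m ≤ L^d / 4` on every even torus, `d ≥ 3`. -/
theorem hypercubeLowerBoundExp_of_le_quarter (hd : 3 ≤ d) [NeZero L] (hL : Even L) {J m : ℕ} (hm : m ≤ L ^ d / 4) :
    HypercubeLowerBoundExp d L J m :=
  hypercubeLowerBoundExp_anti hm (hypercubeLowerBoundExp_quarter hd hL J)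

/-- And the weak form (2.14): `Z_Λ({c_j}) ≥ 1` on every even torus, `d ≥ 3`, for admissible coefficients. -/
theorem one_le_torusZ_even (hd : 3 ≤ d) [NeZero L] (hL : Even L) (J : ℕ) {c : ℕ → ℝ} (hc : CoeffAdmissible c) :
    1 ≤ torusZ d L J c :=
  one_le_torusZ_of_hypercubeLowerBoundExp (hypercubeLowerBoundExp_quarter hd hL J) hc

end Summit.Ventures.YMGap.Census

end
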